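import Literature.Geometry.Riemannian.HeatKernelLogSobolev
import Literature.Geometry.Riemannian.LipschitzSmoothing
import Literature.Probability.Moments.HerbstArgument
import HarnessLib

/-!
# Gaussian concentration of the conjugate heat kernel measures of a Ricci flow
# (Hein–Naber 2014, §1.3 and §3.2; Bamler 2020a, proof of Thm. 3.12)

H.-J. Hein, A. Naber, *New logarithmic Sobolev inequalities and an ε-regularity theorem for the
Ricci flow*, Comm. Pure Appl. Math. 67 (2014), §1.3 (the Gaussian concentration theorem,
Theorem 12 of arXiv:1205.0380) with proof in §3.2: for a Ricci flow on a closed manifold and a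
conjugate heat kernel measure `dν = dν_{x,t;s} = K(x,t;·,s) dg_s`, `s < t`,

  `ν(A) ν(B) ≤ exp(−dist_{g_s}(A, B)² / (8 (t − s)))`   for all `A, B ⊆ M`.

R. Bamler, *Entropy and heat kernel bounds on a Ricci flow background*, arXiv:2008.07093
(2020a), proof of Thm. 3.12 ("The first bound follows from [Hein–Naber-14] applied to the
subsets …") consumes exactly this statement.

This file proves it (`heatKernelMeasure_real_mul_real_le_exp`) for a Ricci flow
`hflow = (h, cov)` on `[a, T]` of a `C^∞` family of Riemannian metrics on a closed connected
manifold `M` (modelled on `ℝᵐ`), `a < s < t ≤ T`, the tree's heat kernel measures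
`ν = heatKernelMeasure hh hR t x s` (`HeatKernelMeasures.lean`), and two measurable sets `A`, `B`
separated by a *1-Lipschitz witness*: a continuous `ψ` with `|ψ y − ψ z| ≤ d_{g_s}(y, z)`
(in `ℝ≥0∞`), `ψ ≤ α` on `A` and `ψ ≥ α + d` on `B` (`d ≥ 0`); e.g. `ψ = dist_{g_s}(·, A)`,
`d = dist_{g_s}(A, B)`. The conclusion is `ν(A) ν(B) ≤ exp(−d² / (8 (t − s)))`.

The proof is Hein–Naber's (§3.2, Herbst's argument following Ledoux): by the smoothing lemma
`exists_contMDiff_abs_sub_lt_gradSq_le` replace `ψ` by a smooth `χ` with `|χ − ψ| < ε`,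
`|∇χ|²_{g_s} ≤ (1 + ε)²`; the log-Sobolev inequality `heinNaber_logSobolev_heatKernelMeasure`
applied to `φ = e^{lχ}` (`|∇φ|²/φ = l² e^{lχ} |∇χ|²`) is the entropy bound
`Ent_ν(e^{lχ}) ≤ (t − s)(1 + ε)² l² ∫ e^{lχ} dν` (`entropy_exp_mul_le_of_gradSq_le`); Herbst's
argument (`Literature.Probability.Moments.herbst_laplace_and_tail_bound`) turns it into the
Laplace bound `∫ e^{l(χ − ∫χ)} dν ≤ e^{c l²}`, `c = (t − s)(1 + ε)²`; two Chernoff bounds on `A`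
(parameter `−l`) and `B` (parameter `l`) multiply to `ν(A) ν(B) ≤ e^{2cl² − l(d − 2ε)}`, and
`l = (d − 2ε)/(4c)` gives `exp(−(d − 2ε)²/(8c))`
(`measureReal_mul_measureReal_le_exp_of_laplace_le`, pure measure theory); finally `ε → 0⁺`.

Everything is proved; no definitions, no named facts. What is NOT here: the set-distance
formulation itself (the caller supplies the Lipschitz witness `ψ`, e.g. a distance function),
Bamler's `H_n`-sharpened variance and concentration bounds (Bamler 2020a, §3), the heat kernel
upper bounds Hein–Naber derive from the concentration inequality (Corollary 13 of the arXiv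
numbering), non-compact `M`.

## References

* H.-J. Hein, A. Naber, *New logarithmic Sobolev inequalities and an ε-regularity theorem for the
  Ricci flow*, Comm. Pure Appl. Math. 67 (2014), 1543–1561, §1.3 and §3.2 (arXiv:1205.0380,
  Thm. 12). [HeinNaber2014]
* R. H. Bamler, *Entropy and heat kernel bounds on a Ricci flow background*, arXiv:2008.07093
  (2020), §3, proof of Thm. 3.12. [Bamler2020Entropy]
* D. Bakry, I. Gentil, M. Ledoux, *Analysis and Geometry of Markov Diffusion Operators*,
  Grundlehren 348, Springer (2014), Prop. 5.4.1 and (5.4.2) (Herbst's argument).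
  [BakryGentilLedoux2014]
-/

noncomputable section

open Bundle Set Function Filter Manifold MeasureTheory Measure TopologicalSpace
open scoped Manifold ContDiff Topology ENNReal NNReal

namespace Literature.Geometry.Riemannian

open Lorentzian Lorentzian.PseudoRiemannianMetric

/-! ### Herbst–Chernoff: concentration between two sets from a Laplace bound -/

section Chernoff

variable {Ω : Type*} [MeasurableSpace Ω]

/-- **Concentration between two sets from a sub-Gaussian Laplace bound** (the last step of
Hein–Naber 2014, §3.2 / Ledoux): if `χ` is bounded measurable on a probability space with
`∫ e^{l(χ − m)} dν ≤ e^{c l²}` for all real `l` (`c > 0`), and `χ ≤ u` on `A`, `χ ≥ v` on `B`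
with `u ≤ v`, then `ν(A) ν(B) ≤ exp(−(v − u)²/(8c))`: the Chernoff bounds
`ν(B) e^{l(v − m)} ≤ e^{cl²}` and `ν(A) e^{l(m − u)} ≤ e^{cl²}` (parameter `−l`) multiply to
`ν(A) ν(B) ≤ e^{2cl² − l(v − u)}`, optimal at `l = (v − u)/(4c)`.
[cite: HeinNaber2014, §3.2, proof of the Gaussian concentration theorem] -/
theorem measureReal_mul_measureReal_le_exp_of_laplace_le (ν : Measure Ω)
    [IsProbabilityMeasure ν] {χ : Ω → ℝ} (hχ : Measurable χ) {C : ℝ} (hC : ∀ y, |χ y| ≤ C)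
    {c m : ℝ} (hc : 0 < c)
    (hLap : ∀ l : ℝ, ∫ y, Real.exp (l * (χ y - m)) ∂ν ≤ Real.exp (c * l ^ 2))
    {A B : Set Ω} (hA : MeasurableSet A) (hB : MeasurableSet B) {u v : ℝ} (huv : u ≤ v)
    (hAu : ∀ y ∈ A, χ y ≤ u) (hBv : ∀ y ∈ B, v ≤ χ y) :
    ν.real A * ν.real B ≤ Real.exp (-(v - u) ^ 2 / (8 * c)) := by
  set l : ℝ := (v - u) / (4 * c) with hl
  have hl0 : 0 ≤ l := div_nonneg (sub_nonneg.2 huv) (by positivity)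
  -- all exponential moments of the bounded function `χ - m` exist
  have hint : ∀ l' : ℝ, Integrable (fun y ↦ Real.exp (l' * (χ y - m))) ν := fun l' ↦
    Literature.Probability.Moments.integrable_exp_mul_of_abs_le_const ν (hχ.sub_const m)
      (C := C + |m|) (fun y ↦ (abs_sub _ _).trans (by linarith [hC y])) l'
  -- Chernoff bound on `B` with parameter `l`
  have hBb : ν.real B * Real.exp (l * (v - m)) ≤ Real.exp (c * l ^ 2) := by
    calc ν.real B * Real.exp (l * (v - m))
        = ∫ _ in B, Real.exp (l * (v - m)) ∂ν := by rw [setIntegral_const, smul_eq_mul]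
      _ ≤ ∫ y in B, Real.exp (l * (χ y - m)) ∂ν := by
          refine setIntegral_mono_on integrableOn_const (hint l).integrableOn hB fun y hy ↦ ?_
          exact Real.exp_le_exp.2
            (mul_le_mul_of_nonneg_left (sub_le_sub_right (hBv y hy) m) hl0)
      _ ≤ ∫ y, Real.exp (l * (χ y - m)) ∂ν :=
          setIntegral_le_integral (hint l) (ae_of_all _ fun y ↦ (Real.exp_pos _).le)
      _ ≤ Real.exp (c * l ^ 2) := hLap l
  -- Chernoff bound on `A` with parameter `-l`
  have hAb : ν.real A * Real.exp (l * (m - u)) ≤ Real.exp (c * l ^ 2) := by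
    calc ν.real A * Real.exp (l * (m - u))
        = ∫ _ in A, Real.exp (l * (m - u)) ∂ν := by rw [setIntegral_const, smul_eq_mul]
      _ ≤ ∫ y in A, Real.exp (-l * (χ y - m)) ∂ν := by
          refine setIntegral_mono_on integrableOn_const (hint (-l)).integrableOn hA
            fun y hy ↦ Real.exp_le_exp.2 ?_
          have h1 := mul_le_mul_of_nonneg_left (hAu y hy) hl0
          linarith
      _ ≤ ∫ y, Real.exp (-l * (χ y - m)) ∂ν :=
          setIntegral_le_integral (hint (-l)) (ae_of_all _ fun y ↦ (Real.exp_pos _).le)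
      _ ≤ Real.exp (c * (-l) ^ 2) := hLap (-l)
      _ = Real.exp (c * l ^ 2) := by rw [neg_sq]
  -- multiply the two bounds
  have hprod : ν.real A * ν.real B * Real.exp (l * (v - u)) ≤
      Real.exp (c * l ^ 2) * Real.exp (c * l ^ 2) := by
    have h2 : Real.exp (l * (m - u)) * Real.exp (l * (v - m)) = Real.exp (l * (v - u)) := by
      rw [← Real.exp_add]
      ring_nf
    calc ν.real A * ν.real B * Real.exp (l * (v - u))
        = ν.real A * Real.exp (l * (m - u)) * (ν.real B * Real.exp (l * (v - m))) := by
          rw [← h2]; ring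
      _ ≤ Real.exp (c * l ^ 2) * Real.exp (c * l ^ 2) :=
          mul_le_mul hAb hBb (by positivity) (Real.exp_pos _).le
  have hfin := (le_div_iff₀ (Real.exp_pos _)).2 hprod
  rw [← Real.exp_add, ← Real.exp_sub] at hfin
  refine hfin.trans_eq ?_
  congr 1
  rw [hl]
  field_simp
  ring

end Chernoff

/-! ### The geometric input: entropy of `e^{lχ}` under the heat kernel measures -/

section Concentration

variable {m : ℕ} {H : Type*} [TopologicalSpace H]
  {I : ModelWithCorners ℝ (EuclideanSpace ℝ (Fin m)) H} [I.Boundaryless]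
  {M : Type*} [TopologicalSpace M] [ChartedSpace H M] [IsManifold I ∞ M]
  [T2Space M] [CompactSpace M] [SecondCountableTopology M] [MeasurableSpace M] [BorelSpace M]
  [PreconnectedSpace M]
  {h : ℝ → PseudoRiemannianMetric I ∞ (EuclideanSpace ℝ (Fin m)) (TangentSpace I : M → Type _)}
  {cov : ℝ → CovariantDerivative I (EuclideanSpace ℝ (Fin m)) (TangentSpace I : M → Type _)}
  {a T : ℝ}

omit [I.Boundaryless] [T2Space M] [CompactSpace M] [SecondCountableTopology M] [MeasurableSpace M]
  [BorelSpace M] [PreconnectedSpace M] in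
/-- **Gradient square of `e^{lχ}`**: `|∇ e^{lχ}|²_g (x) = (l e^{lχ(x)})² |∇χ|²_g (x)`
(chain rule `d(e^{lχ}) = l e^{lχ} dχ`, `mvfderiv_real_comp`, and bilinearity of `g⁻¹`).
[folklore] -/
theorem gradSq_exp_const_mul
    (g : PseudoRiemannianMetric I ∞ (EuclideanSpace ℝ (Fin m)) (TangentSpace I : M → Type _))
    {χ : M → ℝ} {x : M} (hχ : MDifferentiableAt I 𝓘(ℝ, ℝ) χ x) (l : ℝ) :
    g.gradSq (fun y ↦ Real.exp (l * χ y)) x =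
      (l * Real.exp (l * χ x)) ^ 2 * g.gradSq χ x := by
  have hζ : HasDerivAt (fun v : ℝ ↦ Real.exp (l * v)) (l * Real.exp (l * χ x)) (χ x) :=
    ((Real.hasDerivAt_exp (l * χ x)).comp (χ x) ((hasDerivAt_id' (χ x)).const_mul l)).congr_deriv
      (by ring)
  have hd : mvfderiv I (fun y ↦ Real.exp (l * χ y)) x =
      (l * Real.exp (l * χ x)) • mvfderiv I χ x := by
    ext v
    rw [_root_.smul_apply, smul_eq_mul,
      show (fun y ↦ Real.exp (l * χ y)) = (fun v : ℝ ↦ Real.exp (l * v)) ∘ χ from rfl,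
      mvfderiv_real_comp hζ.differentiableAt hχ v, hζ.deriv]
  simp only [gradSq_eq, hd, ContinuousLinearMap.toLinearMap_smul, map_smul, _root_.smul_apply,
    smul_eq_mul]
  ring

/-- **Entropy bound for `e^{lχ}` under the heat kernel measures** (Hein–Naber 2014, §3.2,
"((e:logsob)) applied to `φ² = e^{λF}` … yields `dU/dλ ≤ |s|`"): for a Ricci flow `(h, cov)` on
`[a, T]` (smooth family of Riemannian metrics on a closed connected manifold), `a < s < t ≤ T`,
`ν = ν_{x,t;s}`, and a smooth `χ` with `|∇χ|²_{h(s)} ≤ Λ` everywhere, for every real `l`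

  `∫ e^{lχ} (lχ) dν − (∫ e^{lχ} dν) log (∫ e^{lχ} dν) ≤ (t − s) Λ l² ∫ e^{lχ} dν`

(the log-Sobolev inequality `heinNaber_logSobolev_heatKernelMeasure` for `φ = e^{lχ}`, whose
Fisher information is `|∇φ|²/φ = l² e^{lχ} |∇χ|² ≤ Λ l² φ`).
[cite: HeinNaber2014, §3.2, proof of the Gaussian concentration theorem] -/
theorem entropy_exp_mul_le_of_gradSq_le (hflow : IsRicciFlow h cov (Icc a T))
    (hh : IsContMDiffFamilyOn ∞ h univ) (hR : ∀ r, (h r).IsRiemannian) {s t : ℝ} (has : a < s)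
    (hst : s < t) (htT : t ≤ T) (x : M) {χ : M → ℝ} (hχ : ContMDiff I 𝓘(ℝ, ℝ) ∞ χ) {Λ : ℝ}
    (hΛ : ∀ y, (h s).gradSq χ y ≤ Λ) (l : ℝ) :
    ∫ y, Real.exp (l * χ y) * (l * χ y) ∂(heatKernelMeasure hh hR t x s) -
        (∫ y, Real.exp (l * χ y) ∂(heatKernelMeasure hh hR t x s)) *
          Real.log (∫ y, Real.exp (l * χ y) ∂(heatKernelMeasure hh hR t x s)) ≤
      (t - s) * Λ * l ^ 2 * ∫ y, Real.exp (l * χ y) ∂(heatKernelMeasure hh hR t x s) := by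
  have hφs : ContMDiff I 𝓘(ℝ, ℝ) ∞ (fun y ↦ Real.exp (l * χ y)) :=
    Real.contDiff_exp.comp_contMDiff (contMDiff_const.mul hχ)
  have hφpos : ∀ y, 0 < Real.exp (l * χ y) := fun y ↦ Real.exp_pos _
  have hLS := heinNaber_logSobolev_heatKernelMeasure hflow hh hR has hst htT x hφs hφpos
  simp only [Real.log_exp] at hLS
  refine hLS.trans ?_
  have hχd : ∀ y, MDifferentiableAt I 𝓘(ℝ, ℝ) χ y := fun y ↦ hχ.mdifferentiableAt (by simp)
  -- pointwise: `|∇φ|²/φ = l² e^{lχ} |∇χ|² ≤ Λ l² e^{lχ}`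
  have hpt : ∀ y, (h s).gradSq (fun y ↦ Real.exp (l * χ y)) y / Real.exp (l * χ y) ≤
      Λ * l ^ 2 * Real.exp (l * χ y) := by
    intro y
    rw [gradSq_exp_const_mul (h s) (hχd y) l, div_le_iff₀ (hφpos y)]
    have h1 : 0 ≤ l ^ 2 * Real.exp (l * χ y) := by positivity
    have h2 := mul_le_mul_of_nonneg_left (hΛ y) h1
    calc (l * Real.exp (l * χ y)) ^ 2 * (h s).gradSq χ y
        = Real.exp (l * χ y) * (l ^ 2 * Real.exp (l * χ y) * (h s).gradSq χ y) := by ring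
      _ ≤ Real.exp (l * χ y) * (l ^ 2 * Real.exp (l * χ y) * Λ) :=
          mul_le_mul_of_nonneg_left h2 (hφpos y).le
      _ = Λ * l ^ 2 * Real.exp (l * χ y) * Real.exp (l * χ y) := by ring
  have hnn : ∀ y, 0 ≤ (h s).gradSq (fun y ↦ Real.exp (l * χ y)) y / Real.exp (l * χ y) :=
    fun y ↦ div_nonneg (PseudoRiemannianMetric.innerDual_self_nonneg (h s) (hR s) y _)
      (hφpos y).le
  have hcont : Continuous fun y ↦ Λ * l ^ 2 * Real.exp (l * χ y) :=
    continuous_const.mul (Real.continuous_exp.comp (continuous_const.mul hχ.continuous))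
  have hint : Integrable (fun y ↦ Λ * l ^ 2 * Real.exp (l * χ y))
      (heatKernelMeasure hh hR t x s) :=
    hcont.integrable_of_hasCompactSupport (HasCompactSupport.of_compactSpace _)
  have hmono := integral_mono_of_nonneg (ae_of_all _ hnn) hint (ae_of_all _ hpt)
  rw [integral_const_mul] at hmono
  calc (t - s) * ∫ y, (h s).gradSq (fun y ↦ Real.exp (l * χ y)) y / Real.exp (l * χ y)
          ∂(heatKernelMeasure hh hR t x s)
      ≤ (t - s) * (Λ * l ^ 2 * ∫ y, Real.exp (l * χ y) ∂(heatKernelMeasure hh hR t x s)) :=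
        mul_le_mul_of_nonneg_left hmono (sub_pos.2 hst).le
    _ = (t - s) * Λ * l ^ 2 * ∫ y, Real.exp (l * χ y) ∂(heatKernelMeasure hh hR t x s) := by
        ring

/-- **Gaussian concentration of the conjugate heat kernel measures of a Ricci flow**
(Hein–Naber 2014, §1.3, Theorem 12 of arXiv:1205.0380, proof in §3.2; the input of Bamler
2020a, proof of Thm. 3.12). Let `(h, cov)` be a Ricci flow on `[a, T]` of a smooth family of
Riemannian metrics on a closed connected manifold `M`, `a < s < t ≤ T`, `x ∈ M`,
`ν = ν_{x,t;s}` the conjugate heat kernel measure, and let the measurable sets `A, B ⊆ M` be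
separated by a `1`-Lipschitz witness: `ψ : M → ℝ` continuous with
`|ψ y − ψ z| ≤ d_{h(s)}(y, z)`, `ψ ≤ α` on `A`, `ψ ≥ α + d` on `B`, `d ≥ 0`. Then

  `ν(A) ν(B) ≤ exp(−d² / (8 (t − s)))`.

Proof: smoothing of `ψ` (`exists_contMDiff_abs_sub_lt_gradSq_le`: `|χ − ψ| < ε`,
`|∇χ|² ≤ (1 + ε)²`), the entropy bound `entropy_exp_mul_le_of_gradSq_le`, Herbst's argument
`herbst_laplace_and_tail_bound` with `c = (t − s)(1 + ε)²`, the two-set Chernoff bound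
`measureReal_mul_measureReal_le_exp_of_laplace_le` with `u = α + ε`, `v = α + d − ε`, and
`ε → 0⁺`. [cite: HeinNaber2014, §1.3 and §3.2, Gaussian concentration theorem]
[cite: Bamler2020Entropy, §3, proof of Thm. 3.12] -/
theorem heatKernelMeasure_real_mul_real_le_exp (hflow : IsRicciFlow h cov (Icc a T))
    (hh : IsContMDiffFamilyOn ∞ h univ) (hR : ∀ r, (h r).IsRiemannian) {s t : ℝ} (has : a < s)
    (hst : s < t) (htT : t ≤ T) (x : M) {ψ : M → ℝ} (hψc : Continuous ψ)
    (hψ : ∀ y z, ENNReal.ofReal |ψ y - ψ z| ≤ (h s).edist (hR s) y z)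
    {A B : Set M} {α d : ℝ} (hA : MeasurableSet A) (hB : MeasurableSet B) (hd : 0 ≤ d)
    (hAα : ∀ y ∈ A, ψ y ≤ α) (hBα : ∀ y ∈ B, α + d ≤ ψ y) :
    (heatKernelMeasure hh hR t x s).real A * (heatKernelMeasure hh hR t x s).real B ≤
      Real.exp (-d ^ 2 / (8 * (t - s))) := by
  have hτ : 0 < t - s := sub_pos.2 hst
  -- the degenerate case `d = 0`: a product of probabilities is at most `1`
  rcases hd.eq_or_lt with rfl | hdpos
  · have h1 : (heatKernelMeasure hh hR t x s).real A * (heatKernelMeasure hh hR t x s).real B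
        ≤ 1 := mul_le_one₀ measureReal_le_one measureReal_nonneg measureReal_le_one
    simpa using h1
  -- for `0 < ε`, `2ε ≤ d`: the bound with `d - 2ε` and `c = (t - s)(1 + ε)²`
  have key : ∀ ε : ℝ, 0 < ε → 2 * ε ≤ d →
      (heatKernelMeasure hh hR t x s).real A * (heatKernelMeasure hh hR t x s).real B ≤
        Real.exp (-(d - 2 * ε) ^ 2 / (8 * ((t - s) * (1 + ε) ^ 2))) := by
    intro ε hε hεd
    obtain ⟨χ, hχs, hχψ, hχg⟩ := exists_contMDiff_abs_sub_lt_gradSq_le (h s) (hR s) hψc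
      zero_le_one (F := ψ) (fun y z ↦ by rw [ENNReal.ofReal_one, one_mul]; exact hψ y z) hε
    have hc : 0 < (t - s) * (1 + ε) ^ 2 := by positivity
    have hχm : Measurable χ := hχs.continuous.measurable
    obtain ⟨C, hC⟩ : ∃ C : ℝ, ∀ y, |χ y| ≤ C := by
      obtain ⟨C, hC⟩ :=
        isCompact_univ.exists_bound_of_continuousOn hχs.continuous.continuousOn
      exact ⟨C, fun y ↦ by simpa [Real.norm_eq_abs] using hC y (mem_univ y)⟩
    have hEnt := entropy_exp_mul_le_of_gradSq_le hflow hh hR has hst htT x hχs hχg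
    have hLap := (Literature.Probability.Moments.herbst_laplace_and_tail_bound
      (heatKernelMeasure hh hR t x s) hχm ⟨C, hC⟩ hc hEnt).1
    have hmain := measureReal_mul_measureReal_le_exp_of_laplace_le
      (heatKernelMeasure hh hR t x s) hχm hC hc hLap hA hB (u := α + ε) (v := α + d - ε)
      (by linarith) (fun y hy ↦ by linarith [(abs_lt.1 (hχψ y)).2, hAα y hy])
      (fun y hy ↦ by linarith [(abs_lt.1 (hχψ y)).1, hBα y hy])
    calc _ ≤ _ := hmain
      _ = _ := by congr 1; ring
  -- let `ε → 0⁺`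
  have hcont : ContinuousAt
      (fun ε : ℝ ↦ Real.exp (-(d - 2 * ε) ^ 2 / (8 * ((t - s) * (1 + ε) ^ 2)))) 0 := by
    fun_prop (disch := positivity)
  have htend := hcont.tendsto
  simp only [mul_zero, sub_zero, add_zero, one_pow, mul_one] at htend
  have htend' : Tendsto (fun ε : ℝ ↦ Real.exp (-(d - 2 * ε) ^ 2 / (8 * ((t - s) * (1 + ε) ^ 2))))
      (𝓝[>] 0) (𝓝 (Real.exp (-d ^ 2 / (8 * (t - s))))) := htend.mono_left nhdsWithin_le_nhds
  refine ge_of_tendsto htend' ?_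
  filter_upwards [Ioo_mem_nhdsGT (half_pos hdpos)] with ε hε
  exact key ε hε.1 (by linarith [hε.2])

end Concentration

end Literature.Geometry.Riemannian
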